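import Literature.Computability.Complexity.QuadraticCongruencesFactMachine
import Literature.Computability.Complexity.OneInThreeSubsetSumMachine
import Literature.Computability.Complexity.ReductionsProofs
import HarnessLib

/-!
# QUADRATIC CONGRUENCES WITH FACTORISATION is NP-complete (assembly; Garey–Johnson [AN1], Manders–Adleman 1978)

Sibling proof file of `QuadraticCongruences.lean` for the named fact
`isNPComplete_QUADCONGFACT : IsNPComplete QUADCONGFACT` (Garey–Johnson [AN1], Comment: "Remains
NP-complete even if the instance includes a prime factorization of `b`"; Manders–Adleman 1978, §2,
Theorem 2 with the Remark "the problems are still NP-complete when `β` is given in fully factored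
form"). Assembly of

* `QUADCONGFACT_mem_NP` (`QuadraticCongruencesFactNP.lean`);
* the transformation and its correctness (`QuadraticCongruencesReduction.lean`,
  `Reduction.mem_partitionSet_iff_code_mem`) and its polynomial-time machine
  (`QuadraticCongruencesFactMachine.lean`, `QuadCongFP.outF_encode`, `outF_mem_FP`), giving
  **`PARTITION_karpReducible_QUADCONGFACT : PARTITION ≤ₚ QUADCONGFACT`** through the guarded map
  `reduceFn` (list codes ↦ `outF`, other strings ↦ `ε ∉ QUADCONGFACT`);
* the tree's `Knapsack.KNAPSACK_karpReducible_PARTITION` (Karp 1972) and the named fact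
  `isNPComplete_KNAPSACK` (Karp's problem 18) with its discharge `isNPComplete_KNAPSACK_holds`
  (`OneInThreeSubsetSumMachine.lean`: Cook–Levin, `SAT ≤ₚ 3SAT ≤ₚ ONEIN3SAT ≤ₚ KNAPSACK`), whence
  `QUADCONGFACT_isNPHard_of` / `isNPComplete_QUADCONGFACT_of` (from any proof of
  `isNPComplete_KNAPSACK`), `QUADCONGFACT_isNPHard_of_PARTITION`, and unconditionally
  **`QUADCONGFACT_isNPHard`** and the discharge **`isNPComplete_QUADCONGFACT_holds`**.

So the tree's chain of reductions behind the discharge is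
`SAT ≤ₚ 3SAT ≤ₚ ONEIN3SAT ≤ₚ KNAPSACK ≤ₚ PARTITION ≤ₚ QUADCONGFACT` (Garey–Johnson's entry reads
"Transformation from 3SAT"; Manders–Adleman §2.1 notes that the first steps of their transformation
"in fact give a reduction of 3-satisfiability to a convenient special case of knapsack").

## References

* K. L. Manders, L. Adleman, *NP-complete decision problems for binary quadratics*, J. Comput.
  System Sci. 16 (1978) 168–184, §2 Theorem 2, Remark. Held: `doi:10.1016/0022-0000(78)90044-2`.
* M. R. Garey, D. S. Johnson, *Computers and Intractability*, Freeman 1979, §A7.1 [AN1].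
* R. M. Karp, *Reducibility among combinatorial problems* (1972), §4, problems 18, 20.
* S. Arora, B. Barak, *Computational Complexity: A Modern Approach*, CUP 2009, Thm. 2.8.
-/

noncomputable section

namespace Literature.Computability.Complexity

namespace QuadCongFP

open _root_.Computability Polynomial Brick Knapsack QuadCongNP MandersAdleman MandersAdleman.Reduction
open scoped Notation

/-! ### The Karp reduction `PARTITION ≤ₚ QUADCONGFACT` -/

/-- **The reduction function**: Manders–Adleman's transformation `outF` on genuine list codes, the
non-member `ε` on every other string. [cite: MandersAdleman1978, §2.1 (the reduction algorithm)] -/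
def reduceFn : List Bool → List Bool := iteFn isCanonLFn outF fun _ => []

/-- **The reduction is polynomial time.** [cite: MandersAdleman1978, §2.2] -/
theorem reduceFn_mem_FP : reduceFn ∈ FP := iteFn_mem_FP isCanonLFn_mem_FP outF_mem_FP (const_mem_FP _)

/-- Value of `reduceFn` on a list code. [folklore] -/
theorem reduceFn_encode (l : List ℕ) : reduceFn (encodingListNatBool.encode l) = outF (encodingListNatBool.encode l) := by
  have hc : isCanonLFn (encodingListNatBool.encode l) = [true] := by rw [isCanonLFn_apply, decNatList_encode]; simp
  rw [reduceFn, iteFn_apply_true hc]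

/-- Value of `reduceFn` on a non-code. [folklore] -/
theorem reduceFn_of_not_canon {x : List Bool} (hx : encodingListNatBool.encode (decNatList x) ≠ x) : reduceFn x = [] := by
  have hc : isCanonLFn x = [false] := by rw [isCanonLFn_apply]; simp [hx]
  rw [reduceFn, iteFn_apply_false hc]

/-- `ε ∉ QUADCONGFACT` (codes are pairs, of length `≥ 2`). [folklore] -/
theorem nil_not_mem_QUADCONGFACT : ([] : List Bool) ∉ QUADCONGFACT := by
  rintro ⟨⟨a, b, c⟩, -, h⟩
  have := congrArg List.length h
  rw [encodingQuadCongFactored_encode, length_boolPair] at this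
  simp at this

/-- **`PARTITION ≤ₚ QUADCONGFACT`** (the knapsack half of Manders–Adleman's transformation, run on
PARTITION codes: `mem_partitionSet_iff_code_mem` and the machine `outF`).
[cite: MandersAdleman1978, §2 Theorem 2 (proof) and Remark (`β` in factored form)] -/
theorem PARTITION_karpReducible_QUADCONGFACT : PARTITION ≤ₚ QUADCONGFACT := by
  refine ⟨reduceFn, reduceFn_mem_FP, fun x => ?_⟩
  by_cases hx : encodingListNatBool.encode (decNatList x) = x
  · rw [← hx, reduceFn_encode, outF_encode]
    show encodingListNatBool.encode (decNatList x) ∈ encodingListNatBool.toLanguage partitionSet ↔ _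
    rw [encodingListNatBool.mem_toLanguage_iff]
    exact mem_partitionSet_iff_code_mem (decNatList x)
  · rw [reduceFn_of_not_canon hx]
    exact ⟨fun h => (hx (encode_decNatList_of_mem h)).elim, fun h => (nil_not_mem_QUADCONGFACT h).elim⟩

/-! ### NP-hardness and NP-completeness -/

/-- **QUADCONGFACT is NP-hard, given that KNAPSACK is NP-complete** (Karp 1972, problem 18; the tree's
named fact `isNPComplete_KNAPSACK`): `KNAPSACK ≤ₚ PARTITION ≤ₚ QUADCONGFACT`.
[cite: MandersAdleman1978, §2 Theorem 2 and Remark] -/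
theorem QUADCONGFACT_isNPHard_of (hK : isNPComplete_KNAPSACK) : IsNPHard QUADCONGFACT :=
  IsHard.of_reducible_holds (IsHard.of_reducible_holds hK.isHard KNAPSACK_karpReducible_PARTITION)
    PARTITION_karpReducible_QUADCONGFACT

/-- **QUADCONGFACT is NP-complete, given that KNAPSACK is NP-complete.**
[cite: MandersAdleman1978, §2 Theorem 2 and Remark] -/
theorem isNPComplete_QUADCONGFACT_of (hK : isNPComplete_KNAPSACK) : isNPComplete_QUADCONGFACT :=
  ⟨QUADCONGFACT_mem_NP, QUADCONGFACT_isNPHard_of hK⟩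

/-- More generally: QUADCONGFACT is NP-hard as soon as PARTITION is. [cite: MandersAdleman1978, §2 Theorem 2 and Remark] -/
theorem QUADCONGFACT_isNPHard_of_PARTITION (hP : IsNPHard PARTITION) : IsNPHard QUADCONGFACT :=
  IsHard.of_reducible_holds hP PARTITION_karpReducible_QUADCONGFACT

/-- **QUADCONGFACT is NP-hard** (unconditionally, through the tree's `isNPComplete_KNAPSACK_holds`).
[cite: MandersAdleman1978, §2 Theorem 2 and Remark] -/
theorem QUADCONGFACT_isNPHard : IsNPHard QUADCONGFACT := QUADCONGFACT_isNPHard_of isNPComplete_KNAPSACK_holds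

end QuadCongFP

/-- **Discharge of `isNPComplete_QUADCONGFACT`** (Garey–Johnson [AN1] with its Comment; Manders–Adleman
1978, §2 Theorem 2 and the Remark "the problems are still NP-complete when `β` is given in fully
factored form"): QUADRATIC CONGRUENCES, each instance carrying the prime factorisation of its modulus,
is NP-complete — in `NP` by `QUADCONGFACT_mem_NP` (guess `x`, check the congruence and the supplied
factorisation with `PRIMES ∈ P`), NP-hard by `KNAPSACK ≤ₚ PARTITION ≤ₚ QUADCONGFACT`
(`QuadCongFP.PARTITION_karpReducible_QUADCONGFACT`, the Manders–Adleman transformation) from the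
tree's `isNPComplete_KNAPSACK_holds`. [cite: GareyJohnson1979, §A7.1 problem AN1 (Comment)]
[cite: MandersAdleman1978, §2 Theorem 2 and Remark] -/
theorem isNPComplete_QUADCONGFACT_holds : isNPComplete_QUADCONGFACT :=
  QuadCongFP.isNPComplete_QUADCONGFACT_of isNPComplete_KNAPSACK_holds

end Literature.Computability.Complexity

end
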